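import Summits.QuantumFields.GaugeBoot.BootstrapLatticeSymmetry
import Summits.QuantumFields.GaugeBoot.DiagonalRPTorusGaugeInvariantNegative
import HarnessLib

/-!
# Reflection positivity as bootstrap cuts III: the DIAGONAL reflection — the swap map, Polyakov
lines as polynomial observables, and the gauge-invariant polynomial witness (gauge-boot, L3 ↔ L1)

HONEST FRAMING (cell `pub-gaugeboot`, page 1 of every file): the venture produces certified bounds
on lattice expectations at stated coupling, gauge group, dimension and torus size; NOT a mass gap,
NOT a continuum limit, NOT a string tension; NOT Yang–Mills-summit-bearing (barriers
`FixedCouplingUltralocality`, `PerturbativeInvisibility`). Structural; it certifies no number.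

## Content

Kazakov–Zheng (arXiv:2203.11360 §3.1) impose THREE families of reflection-positivity matrices:
site reflections, link reflections and DIAGONAL reflections `x_i ↔ x_j`. The cell's files
`BootstrapReflectionPositivity` / `BootstrapLinkReflectionPositivity` (lean3 gen 76) show that on
the torus the first two families are CONSEQUENCES of the untruncated bootstrap (every solution is
the Wilson expectation, which is site- and link-RP). The cell's task L3 found that the third family is
different: on a torus `(ℤ/L)^d` with `d ≥ 3` the closed-half diagonal reflection positivity FAILS,
at every `β` on even tori and even for gauge-invariant observables
(`DiagRPPolyakov.not_gaugeInvariantDiagonalRP`: the swap moves the back layer `y_i - y_j ≡ L/2`,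
and the difference of two back-layer Polyakov lines is an odd gauge-invariant observable).

This module supplies the bootstrap-side form of that witness, for a general compact metrisable
gauge group `G` and lattice representation `r`:

* `diagSwapCM i j` — the diagonal swap `Θ_{ij}` (`configDiagSwap`) as a continuous self-map of the
  configurations (a relabelling of links, `relabelCM (edgeDiagSwap i j)`);
  `comp_diagSwapCM_mem_polyAlgebra` — the polynomial observables are swap-stable;
* `entriesPoly_rho_lineHolonomy`, `polRe_mem_polyFunctions` — straight Wilson lines and POLYAKOV
  LINES `Re tr ρ(U(x,m) ⋯ U(x+(L-1)e_m, m))` are polynomial observables;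
* `wilson_integral_mul_self_neg_of_odd` — for ANY map `Θ` and any continuous real observable `f`
  with `f ∘ Θ = -f`, `f ≠ 0`: `∫ f(ΘU) f(U) dμ_Wilson = -∫ f² dμ_Wilson < 0` (the Boltzmann weight is
  bounded below and product Haar measure charges open sets: `integral_exp_mul_sq_pos`);
* `wilson_diagRP_real`, `wilson_giDiagRP_real` — real forms of the packaged torus statements
  `DiagonalReflectionPositive ρ β i j` / `GaugeInvariantDiagonalRP ρ β i j` for continuous real
  observables (used where they HOLD: the two-dimensional tori, `DiagRPTwo.*`);
* ★★ `exists_poly_diagSwap_witness` — `d ≥ 3` (pairwise distinct `i, j, m`), `L` even, ANY real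
  `β`, `ρ = r.ρ` with non-constant character: there is a POLYNOMIAL observable `f` (the difference
  `P_{x₀} - P_{θx₀}` of two back-layer Polyakov lines of direction `m`, `x₀ = (L/2) e_i`) which is
  gauge invariant, an observable of the closed diagonal half, odd under the swap, and has
  `∫ f(Θ_{ij}U) f(U) dμ_Wilson < 0`.

The consequences for the lattice bootstrap (every solution violates the diagonal cuts; the
word-level SDP with diagonal cuts is eventually INFEASIBLE on tori of dimension `≥ 3`; soundness in
two dimensions) are drawn in `BootstrapDiagonalReflectionPositivity.lean`.

References: V. Kazakov, Z. Zheng, arXiv:2203.11360 §3.1 (the three reflection families);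
K. Osterwalder, E. Seiler, Ann. Phys. 110 (1978) 440 §2; printed precedent for the torus
obstruction (spin systems, remark without proof): J. Fröhlich, R. Israel, E. H. Lieb, B. Simon,
J. Stat. Phys. 22 (1980) 297 §3; M. Biskup, LNM 1970 (2009) §5.5. Folklore-level; the statements
are, as far as the cell's searches go, not in print.
-/

noncomputable section

open MeasureTheory Filter Topology NormedSpace
open scoped ComplexOrder
open Literature.MathematicalPhysics.QuantumFieldTheory (LatticeRep Site Edge GaugeConfig IsGaugeInvariant
  gaugeTransform lineHolonomy wilsonAction wilsonMeasure wilsonExpectation partitionFunction haarProbability)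
open Literature.MathematicalPhysics.QuantumFieldTheory.WilsonLoopRP (lineHolonomy_congr shift_add_single)

namespace Summit.QuantumFields.GaugeBoot

/-! ## The diagonal swap as a continuous, polynomial-stable self-map -/

section Swap

variable {d L : ℕ} {G : Type*} [Group G] [TopologicalSpace G]

/-- **The diagonal swap `Θ_{ij}`** of the torus `(ℤ/L)^d` (`configDiagSwap i j`: coordinates `i`
and `j` exchanged; no link is reversed) as a continuous self-map of the configurations — the
relabelling of the links by `edgeDiagSwap i j`. [folklore] -/
def diagSwapCM (i j : Fin d) : C(GaugeConfig d L G, GaugeConfig d L G) :=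
  relabelCM (G := G) (edgeDiagSwap (d := d) (L := L) i j)

omit [Group G] in
/-- `diagSwapCM` is the cell's `configDiagSwap`. -/
@[simp] theorem diagSwapCM_apply (i j : Fin d) (U : GaugeConfig d L G) :
    diagSwapCM i j U = configDiagSwap i j U := rfl

variable (r : LatticeRep G)

/-- **The polynomial observables are stable under the diagonal swap.** [folklore] -/
theorem comp_diagSwapCM_mem_polyAlgebra (i j : Fin d) {f : C(GaugeConfig d L G, ℝ)}
    (hf : f ∈ polyAlgebra (ι := Edge d L) r) :
    f.comp (diagSwapCM i j) ∈ polyAlgebra (ι := Edge d L) r :=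
  comp_relabelCM_mem_polyAlgebra r _ hf

end Swap

/-! ## Straight Wilson lines and Polyakov lines are polynomial observables -/

section Polyakov

variable {d L : ℕ} {G : Type*} [Group G] [TopologicalSpace G] (r : LatticeRep G)

/-- The entries of `ρ` of a straight-line holonomy `U(y,m) U(y+e_m,m) ⋯` (`n` steps) are polynomial
observables. -/
theorem entriesPoly_rho_lineHolonomy (m : Fin d) :
    ∀ (n : ℕ) (y : Site d L),
      EntriesPoly (ι := Edge d L) r (fun U : GaugeConfig d L G => r.ρ (lineHolonomy U m n y))
  | 0, y => by
    intro a b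
    have hc : ∀ c : ℝ, (fun _ : GaugeConfig d L G => c) ∈ polyFunctions (ι := Edge d L) r := by
      intro c
      have h : (fun _ : GaugeConfig d L G => c) = algebraMap ℝ (GaugeConfig d L G → ℝ) c := by
        funext U
        simp [Pi.algebraMap_apply]
      rw [h]
      exact Subalgebra.algebraMap_mem _ c
    simp only [lineHolonomy, map_one]
    exact ⟨hc _, hc _⟩
  | n + 1, y => by
    have h := (entriesPoly_rho r ((y, m) : Edge d L)).mul r (entriesPoly_rho_lineHolonomy m n (y.shift m))
    simpa only [lineHolonomy, map_mul] using h

/-- **Polyakov lines are polynomial observables**: `U ↦ Re tr ρ(U(x,m) ⋯ U(x+(L-1)e_m, m))`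
(`DiagRPPolyakov.polRe`) lies in `polyFunctions r`. [folklore] -/
theorem polRe_mem_polyFunctions (m : Fin d) (x : Site d L) :
    (fun U : GaugeConfig d L G => DiagRPPolyakov.polRe r.ρ m U x) ∈ polyFunctions (ι := Edge d L) r :=
  (entriesPoly_rho_lineHolonomy r m L x).trace_re r

/-- The difference of two Polyakov lines as an element of `polyAlgebra`. -/
theorem exists_polRe_sub_polRe_mem_polyAlgebra (m : Fin d) (x₀ x₁ : Site d L) :
    ∃ f ∈ polyAlgebra (ι := Edge d L) r,
      ∀ U : GaugeConfig d L G, f U = DiagRPPolyakov.polRe r.ρ m U x₀ - DiagRPPolyakov.polRe r.ρ m U x₁ := by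
  obtain ⟨g, hg, hgf⟩ := (mem_polyFunctions_iff r).1
    (Subalgebra.sub_mem _ (polRe_mem_polyFunctions r m x₀) (polRe_mem_polyFunctions r m x₁))
  exact ⟨g, hg, fun U => by rw [hgf]; rfl⟩

end Polyakov

/-! ## Real forms: odd observables pair negatively; the packaged torus statements unpacked -/

section Wilson

variable {d L N : ℕ} [NeZero L] {G : Type*} [Group G] [TopologicalSpace G] [IsTopologicalGroup G]
  [CompactSpace G] [MeasurableSpace G] [BorelSpace G] [SecondCountableTopology G]
  (ρ : G →* Matrix (Fin N) (Fin N) ℂ)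

/-- **An observable odd under a map pairs NEGATIVELY with its image**: for a continuous `ρ`, any
real `β`, any map `Θ` of the configurations and any continuous real `f` with `f ∘ Θ = -f` and
`f ≠ 0`, `∫ f(ΘU) f(U) dμ_Wilson < 0` (it equals `-∫ f² dμ_Wilson`, and the torus Wilson measure —
a positive continuous density times product Haar measure — charges the open set `{f ≠ 0}`).
[folklore] -/
theorem wilson_integral_mul_self_neg_of_odd (hρ : Continuous ρ) (β : ℝ)
    (Θ : GaugeConfig d L G → GaugeConfig d L G) (f : C(GaugeConfig d L G, ℝ))
    (hodd : ∀ U, f (Θ U) = -f U) (hne : f ≠ 0) :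
    ∫ U, f (Θ U) * f U ∂(wilsonMeasure (d := d) (L := L) ρ β) < 0 := by
  obtain ⟨U₀, hU₀⟩ : ∃ U, f U ≠ 0 := by
    by_contra h
    push Not at h
    exact hne (ContinuousMap.ext h)
  -- the Wilson integral as `Z⁻¹ ∫ e^{-βS} (·) dπ`
  have hkey : ∫ U, f (Θ U) * f U ∂(wilsonMeasure (d := d) (L := L) ρ β) =
      ((partitionFunction (d := d) (L := L) ρ β)⁻¹).toReal *
        ∫ U, Real.exp (-β * wilsonAction ρ U) * (f (Θ U) * f U)
          ∂(Measure.pi fun _ : Edge d L => haarProbability G) := by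
    have h := wilsonExpectation_ofReal_eq (d := d) (L := L) ρ hρ β (fun U => f (Θ U) * f U)
    rw [wilsonExpectation, integral_complex_ofReal] at h
    exact_mod_cast h
  have hrw : (fun U : GaugeConfig d L G => Real.exp (-β * wilsonAction ρ U) * (f (Θ U) * f U)) =
      fun U => -(Real.exp (-β * wilsonAction ρ U) * f U ^ 2) := funext fun U => by
    rw [hodd]; ring
  have hpos := integral_exp_mul_sq_pos (d := d) (L := L) ρ hρ β (h := fun U => f U)
    f.continuous.measurable (C := ‖f‖)
    (fun U => by rw [← Real.norm_eq_abs]; exact f.norm_coe_le_norm U)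
    (isOpen_compl_singleton.preimage f.continuous) ⟨U₀, hU₀⟩ (fun U hU => hU)
  rw [hkey, hrw, integral_neg, mul_neg]
  exact neg_neg_of_pos hpos

/-- **Closed-half diagonal RP in real form**: where the packaged torus statement
`DiagonalReflectionPositive ρ β i j` holds (e.g. odd two-tori at `β ≥ 0`, `DiagRPTwo.*`), every
continuous real observable `f` of the closed diagonal half has `0 ≤ ∫ f(Θ_{ij}U) f(U) dμ_Wilson`.
[folklore] -/
theorem wilson_diagRP_real {β : ℝ} {i j : Fin d}
    (h : DiagonalReflectionPositive (d := d) (L := L) ρ β i j) (f : C(GaugeConfig d L G, ℝ))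
    (hfH : IsDiagonalHalfObservable i j (⇑f)) :
    0 ≤ ∫ U, f (configDiagSwap i j U) * f U ∂(wilsonMeasure (d := d) (L := L) ρ β) := by
  have h' := h (fun U => (f U : ℂ)) (Complex.continuous_ofReal.comp f.continuous).measurable
    ⟨‖f‖, fun U => by simpa using f.norm_coe_le_norm U⟩ (fun U V hUV => by simp only [hfH U V hUV])
  simp only [wilsonExpectation, Complex.conj_ofReal, ← Complex.ofReal_mul] at h'
  rw [integral_complex_ofReal] at h'
  exact_mod_cast h'

/-- **Gauge-invariant closed-half diagonal RP in real form**: where `GaugeInvariantDiagonalRP ρ β i j`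
holds (e.g. EVEN two-tori `L ≥ 4` at every real `β`, `DiagRPTwo.gaugeInvariantDiagonalRP_two_even_allGroups`),
every continuous real GAUGE-INVARIANT observable `f` of the closed diagonal half has
`0 ≤ ∫ f(Θ_{ij}U) f(U) dμ_Wilson`. [folklore] -/
theorem wilson_giDiagRP_real {β : ℝ} {i j : Fin d}
    (h : GaugeInvariantDiagonalRP (d := d) (L := L) ρ β i j) (f : C(GaugeConfig d L G, ℝ))
    (hfH : IsDiagonalHalfObservable i j (⇑f)) (hfg : IsGaugeInvariant (⇑f)) :
    0 ≤ ∫ U, f (configDiagSwap i j U) * f U ∂(wilsonMeasure (d := d) (L := L) ρ β) := by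
  have h' := h (fun U => (f U : ℂ)) (Complex.continuous_ofReal.comp f.continuous).measurable
    ⟨‖f‖, fun U => by simpa using f.norm_coe_le_norm U⟩ (fun U V hUV => by simp only [hfH U V hUV])
    (fun g U => by simp only [hfg g U])
  simp only [wilsonExpectation, Complex.conj_ofReal, ← Complex.ofReal_mul] at h'
  rw [integral_complex_ofReal] at h'
  exact_mod_cast h'

end Wilson

/-! ## The gauge-invariant polynomial witness in `d ≥ 3` -/

section Witness

variable {d L : ℕ} [NeZero L] {G : Type*} [Group G] [TopologicalSpace G] [IsTopologicalGroup G]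
  [CompactSpace G] [MeasurableSpace G] [BorelSpace G] [SecondCountableTopology G] (r : LatticeRep G)

/-- ★★ **The polynomial witness against diagonal RP on tori of dimension `≥ 3`.** Let `i, j, m` be
pairwise distinct directions of `(ℤ/L)^d`, `L` even, `β` any real, and let the character of
`ρ = r.ρ` be non-constant (`Re tr ρ(g) ≠ N` for some `g`). Then there is a POLYNOMIAL observable
`f` — the difference `P_{x₀} - P_{θx₀}` of the two back-layer Polyakov lines of direction `m`
through `x₀ = (L/2) e_i` and `θ x₀ = (L/2) e_j` — which is an observable of the closed diagonal
half `{0 ≤ (y_i - y_j) mod L ≤ L/2}`, gauge invariant, ODD under the swap `Θ_{ij}`, and pairs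
negatively: `∫ f(Θ_{ij}U) f(U) dμ_Wilson < 0`. (Geometry as in
`DiagRPPolyakov.exists_gaugeInvariant_wilsonExpectation_neg`; polynomiality is the new point.) -/
theorem exists_poly_diagSwap_witness (hL : Even L) (hρN : ∃ g, ((r.ρ g).trace).re ≠ r.N) (β : ℝ)
    {i j m : Fin d} (hij : i ≠ j) (hmi : m ≠ i) (hmj : m ≠ j) :
    ∃ f ∈ polyAlgebra (ι := Edge d L) r,
      IsDiagonalHalfObservable i j (⇑f) ∧ IsGaugeInvariant (⇑f) ∧
        (∀ U, f (configDiagSwap i j U) = -f U) ∧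
          ∫ U, f (configDiagSwap i j U) * f U ∂(wilsonMeasure (d := d) (L := L) r.ρ β) < 0 := by
  classical
  have h2 : 2 ≤ L := by
    obtain ⟨k, hk⟩ := hL
    have := NeZero.pos L
    omega
  obtain ⟨g₀, hg₀⟩ := hρN
  obtain ⟨k, hk⟩ := hL
  -- the back-layer value `c = L/2` and the two base points
  set c : ZMod L := ((L / 2 : ℕ) : ZMod L) with hc
  have hc_val : c.val = L / 2 := by
    rw [hc, ZMod.val_natCast]; exact Nat.mod_eq_of_lt (by omega)
  have hc_ne : c ≠ 0 := by
    intro h; rw [h, ZMod.val_zero] at hc_val; omega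
  have hc_neg : -c = c := by
    have h2c : c + c = 0 := by
      rw [hc, ← Nat.cast_add, show L / 2 + L / 2 = L by omega, ZMod.natCast_self]
    exact neg_eq_of_add_eq_zero_left h2c
  set x₀ : Site d L := Pi.single i c with hx₀
  set x₁ : Site d L := siteDiagSwap i j x₀ with hx₁
  have hx₀i : x₀ i = c := by simp [hx₀]
  have hx₀j : x₀ j = 0 := by simp [hx₀, Pi.single_eq_of_ne' hij]
  have hx₁i : x₁ i = 0 := by simp [hx₁, siteDiagSwap, Equiv.swap_apply_left, hx₀j]
  have hx₁j : x₁ j = c := by simp [hx₁, siteDiagSwap, Equiv.swap_apply_right, hx₀i]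
  have hθx₁ : siteDiagSwap i j x₁ = x₀ := siteDiagSwap_siteDiagSwap i j x₀
  have hk₀ : (x₀ i - x₀ j).val = L / 2 := by rw [hx₀i, hx₀j, sub_zero, hc_val]
  have hk₁ : (x₁ i - x₁ j).val = L / 2 := by rw [hx₁i, hx₁j, zero_sub, hc_neg, hc_val]
  -- the polynomial observable `f = P_{x₀} - P_{x₁}`
  obtain ⟨f, hf, hfeq⟩ := exists_polRe_sub_polRe_mem_polyAlgebra (d := d) (L := L) r m x₀ x₁
  have hf_odd : ∀ U, f (configDiagSwap i j U) = -f U := fun U => by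
    rw [hfeq, hfeq, DiagRPPolyakov.polRe_configDiagSwap r.ρ hmi hmj,
      DiagRPPolyakov.polRe_configDiagSwap r.ρ hmi hmj, ← hx₁, hθx₁]
    ring
  refine ⟨f, hf, ?_, ?_, hf_odd, ?_⟩
  · -- an observable of the back layer, hence of the closed half
    refine IsDiagonalLayerObservable.isDiagonalHalfObservable fun U V hUV => ?_
    have e0 : DiagRPPolyakov.polRe r.ρ m U x₀ = DiagRPPolyakov.polRe r.ρ m V x₀ :=
      DiagRPPolyakov.polRe_congr r.ρ hmi hmj x₀ fun z hz => hUV (z, m) hmi hmj (by rw [hz, hk₀])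
    have e1 : DiagRPPolyakov.polRe r.ρ m U x₁ = DiagRPPolyakov.polRe r.ρ m V x₁ :=
      DiagRPPolyakov.polRe_congr r.ρ hmi hmj x₁ fun z hz => hUV (z, m) hmi hmj (by rw [hz, hk₁])
    rw [hfeq, hfeq, e0, e1]
  · -- gauge invariant
    intro g U
    rw [hfeq, hfeq, DiagRPPolyakov.polRe_gaugeTransform, DiagRPPolyakov.polRe_gaugeTransform]
  · -- negative pairing: `f` is odd and not identically zero
    refine wilson_integral_mul_self_neg_of_odd r.ρ r.continuous β (configDiagSwap i j) f hf_odd ?_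
    -- a configuration on which `f ≠ 0`: `g₀` on the link `(x₀, m)`, `1` elsewhere
    set U₁ : GaugeConfig d L G := Function.update (fun _ => (1 : G)) (x₀, m) g₀ with hU₁
    have hline₁ : lineHolonomy U₁ m L x₁ = 1 := by
      rw [← DiagRPPolyakov.lineHolonomy_one (G := G) m L x₁]
      refine lineHolonomy_congr m L x₁ fun s _ => ?_
      have hne : (x₁ + Pi.single m (s : ZMod L), m) ≠ (x₀, m) := by
        intro heq
        have := congrFun (congrArg Prod.fst heq) i
        simp only [Pi.add_apply, hx₁i, hx₀i, Pi.single_eq_of_ne hmi.symm, add_zero] at this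
        exact hc_ne this.symm
      rw [hU₁, Function.update_of_ne hne]
    have hline₀ : lineHolonomy U₁ m L x₀ = g₀ := by
      have key : ∀ n : ℕ, n = L → lineHolonomy U₁ m n x₀ = g₀ := by
        intro n hn
        obtain ⟨L', rfl⟩ : ∃ L', n = L' + 1 := ⟨n - 1, by omega⟩
        have hrest : lineHolonomy U₁ m L' (x₀.shift m) = 1 := by
          rw [← DiagRPPolyakov.lineHolonomy_one (G := G) m L' (x₀.shift m)]
          refine lineHolonomy_congr m L' (x₀.shift m) fun s hs => ?_
          have hne : (x₀.shift m + Pi.single m (s : ZMod L), m) ≠ (x₀, m) := by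
            intro heq
            have := congrFun (congrArg Prod.fst heq) m
            rw [shift_add_single] at this
            simp only [Pi.add_apply, Pi.single_eq_same, hx₀, Pi.single_eq_of_ne hmi, zero_add] at this
            have hv := congrArg ZMod.val this
            rw [ZMod.val_natCast, ZMod.val_zero, Nat.mod_eq_of_lt (by omega)] at hv
            omega
          rw [hU₁, Function.update_of_ne hne]
        rw [lineHolonomy, hrest, mul_one, hU₁, Function.update_self]
      exact key L rfl
    intro hf0
    have hU₁f : f U₁ = 0 := by rw [hf0]; rfl
    rw [hfeq, DiagRPPolyakov.polRe, DiagRPPolyakov.polRe, hline₀, hline₁, map_one, Matrix.trace_one,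
      Fintype.card_fin, Complex.natCast_re, sub_eq_zero] at hU₁f
    exact hg₀ hU₁f

end Witness

end Summit.QuantumFields.GaugeBoot

end
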